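import Literature.Algebra.Homology.DoubleComplexExactRows
import HarnessLib

/-!
# Naturality of the row/column comparison of an augmented double complex

Continuation of `Literature/Algebra/Homology/DoubleComplexExactRows.lean` (Weibel's Acyclic Assembly
Lemma 2.7.3 / Bott–Tu's generalized Mayer–Vietoris principle: for an anticommuting first-quadrant
double complex `K` with exact rows augmented by `A` and exact columns augmented by `B`,
`rowColEquiv : Hⁿ(A) ≃ Hⁿ(B)`). Here we record that this isomorphism is **natural**: a morphism of
doubly augmented double complexes `(K, A, B) → (K', A', B')` (bigraded maps commuting with `d`, `δ`
and the two augmentations) gives a commutative square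
`rowColEquiv' ∘ Hⁿ(A → A') = Hⁿ(B → B') ∘ rowColEquiv` (`ADoubleComplex.rowColEquiv_natural`).
This is the functoriality in the cover of the Čech–de Rham / Čech–Dolbeault isomorphisms
(Bott–Tu (1982), §8, "the restriction map … induces a chain map of double complexes"; Weibel
(1994), 5.6–5.7, naturality of the spectral-sequence comparison), used for the Leray comparison
of two nested acyclic covers in the Cartan–Serre finiteness theorem.

* `NatCochain.Cohomology.map_congr`, `map_id_apply`, `map_map` — functoriality complements for the
  concrete cohomology of `ℕ`-indexed cochain complexes;
* `ADoubleComplex.Hom` — morphisms of anticommuting double complexes; `Hom.total`, `Hom.totTn`,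
  `Hom.totCohMap` (the induced map on total cohomology), `Hom.swap`;
* `ADoubleComplex.RowAugmentation.Hom` — morphisms of row augmentations over a `Hom` (and hence of
  column augmentations over `Hom.swap`); `totMap_cohMap` — the augmentation square commutes;
* `ADoubleComplex.rowColEquiv_natural` — naturality of `rowColEquiv`.

Everything is proved; the only definitions are the morphism structures and induced maps.

## References

* C. A. Weibel, *An Introduction to Homological Algebra* (1994), Lemma 2.7.3, §5.6. [Weibel1994]
* R. Bott, L. W. Tu, *Differential Forms in Algebraic Topology* (1982), §8 (Prop. 8.8, Thm. 8.9).
  [BottTu1982Forms]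
-/

namespace Literature.Algebra.Homology

universe u w₁ w₂ w₃ w₄ w₅ w₆

open Function

variable {R : Type u} [CommRing R]

/-! ### Functoriality complements for `NatCochain.Cohomology.map` -/

namespace NatCochain.Cohomology

variable {A : ℕ → Type w₁} [∀ n, AddCommGroup (A n)] [∀ n, Module R (A n)]
  {A' : ℕ → Type w₂} [∀ n, AddCommGroup (A' n)] [∀ n, Module R (A' n)]
  {A'' : ℕ → Type w₃} [∀ n, AddCommGroup (A'' n)] [∀ n, Module R (A'' n)]
  {d : ∀ n, A n →ₗ[R] A (n + 1)} {d' : ∀ n, A' n →ₗ[R] A' (n + 1)} {d'' : ∀ n, A'' n →ₗ[R] A'' (n + 1)}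

/-- The induced map on cohomology only depends on the values of the cochain map. [folklore] -/
theorem map_congr (f g : ∀ n, A n →ₗ[R] A' n) (hf : ∀ n x, f (n + 1) (d n x) = d' n (f n x))
    (hg : ∀ n x, g (n + 1) (d n x) = d' n (g n x)) (h : ∀ n x, f n x = g n x) (n : ℕ)
    (c : Cohomology d n) : map f hf n c = map g hg n c := by
  obtain ⟨z, rfl⟩ := mk_surjective d n c
  rw [map_mk, map_mk]
  congr 1
  exact Subtype.ext (h n z)

/-- The identity cochain map induces the identity. [folklore] -/
theorem map_id_apply (hf : ∀ n x, (LinearMap.id : A (n + 1) →ₗ[R] A (n + 1)) (d n x) = d n (LinearMap.id x))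
    (n : ℕ) (c : Cohomology d n) : map (fun n ↦ (LinearMap.id : A n →ₗ[R] A n)) hf n c = c := by
  obtain ⟨z, rfl⟩ := mk_surjective d n c
  rw [map_mk]
  rfl

/-- **Functoriality**: the map induced by a composite is the composite of the induced maps.
[folklore] -/
theorem map_map (f : ∀ n, A n →ₗ[R] A' n) (hf : ∀ n x, f (n + 1) (d n x) = d' n (f n x))
    (g : ∀ n, A' n →ₗ[R] A'' n) (hg : ∀ n x, g (n + 1) (d' n x) = d'' n (g n x)) (n : ℕ)
    (c : Cohomology d n) :
    map g hg n (map f hf n c) =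
      map (fun n ↦ g n ∘ₗ f n) (fun n x ↦ by rw [LinearMap.comp_apply, hf, hg]; rfl) n c := by
  obtain ⟨z, rfl⟩ := mk_surjective d n c
  rw [map_mk, map_mk, map_mk]
  rfl

end NatCochain.Cohomology

/-! ### Morphisms of double complexes -/

namespace ADoubleComplex

variable {X : ℕ → ℕ → Type w₁} [∀ p q, AddCommGroup (X p q)] [∀ p q, Module R (X p q)]
  {X' : ℕ → ℕ → Type w₂} [∀ p q, AddCommGroup (X' p q)] [∀ p q, Module R (X' p q)]

/-- A **morphism of anticommuting double complexes**: bigraded linear maps commuting with both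
differentials (Weibel (1994), 1.2.4; Bott–Tu (1982), §8, "a chain map of double complexes").
[cite: Weibel1994, 1.2.4] -/
structure Hom (K : ADoubleComplex R X) (K' : ADoubleComplex R X') where
  /-- the components -/
  f : ∀ p q, X p q →ₗ[R] X' p q
  /-- compatibility with the vertical differentials -/
  f_d : ∀ p q (x : X p q), f p (q + 1) (K.d p q x) = K'.d p q (f p q x)
  /-- compatibility with the horizontal differentials -/
  f_δ : ∀ p q (x : X p q), f (p + 1) q (K.δ p q x) = K'.δ p q (f p q x)

namespace Hom

variable {K : ADoubleComplex R X} {K' : ADoubleComplex R X'} (φ : Hom K K')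

/-- The morphism on the big modules `Π p q, X p q → Π p q, X' p q`, entrywise. [folklore] -/
def total : (∀ p q, X p q) →ₗ[R] (∀ p q, X' p q) where
  toFun x p q := φ.f p q (x p q)
  map_add' x y := by funext p q; simp
  map_smul' c x := by funext p q; simp

/-- Entries of `φ.total x`. [folklore] -/
@[simp]
theorem total_apply (x : ∀ p q, X p q) (p q : ℕ) : φ.total x p q = φ.f p q (x p q) :=
  rfl

/-- `φ.total` of a single entry is the single entry of its image. [folklore] -/
theorem total_single (p q : ℕ) (v : X p q) : φ.total (single p q v) = single p q (φ.f p q v) := by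
  funext p' q'
  rw [total_apply]
  rcases eq_or_ne p' p with rfl | hp
  · rcases eq_or_ne q' q with rfl | hq
    · rw [single_apply_same, single_apply_same]
    · rw [single_apply_of_ne_snd hq, single_apply_of_ne_snd hq, map_zero]
  · rw [single_apply_of_ne_fst hp, single_apply_of_ne_fst hp, map_zero]

/-- **A morphism of double complexes commutes with the total differentials.**
[cite: Weibel1994, 1.2.6] -/
theorem total_totalD (x : ∀ p q, X p q) : φ.total (K.totalD x) = K'.totalD (φ.total x) := by
  funext p q
  rw [total_apply, totalD_apply, totalD_apply, map_add]
  congr 1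
  · cases p with
    | zero => rw [hPart_apply_zero, hPart_apply_zero, map_zero]
    | succ p => rw [hPart_apply_succ, hPart_apply_succ, φ.f_δ, total_apply]
  · cases q with
    | zero => rw [vPart_apply_zero, vPart_apply_zero, map_zero]
    | succ q => rw [vPart_apply_succ, vPart_apply_succ, φ.f_d, total_apply]

/-- `φ.total` preserves the total degree. [folklore] -/
theorem total_mem_Tn {n : ℕ} {x : ∀ p q, X p q} (hx : x ∈ Tn R n) : φ.total x ∈ Tn R n :=
  fun p q h ↦ by rw [total_apply, hx p q h, map_zero]

/-- The morphism on the homogeneous pieces `Totⁿ K → Totⁿ K'`. [folklore] -/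
def totTn (n : ℕ) : ↥(Tn R (X := X) n) →ₗ[R] ↥(Tn R (X := X') n) :=
  φ.total.restrict fun _ hx ↦ φ.total_mem_Tn hx

/-- Underlying family of `φ.totTn n x`. [folklore] -/
@[simp]
theorem coe_totTn {n : ℕ} (x : ↥(Tn R (X := X) n)) : (φ.totTn n x : ∀ p q, X' p q) = φ.total x :=
  rfl

/-- `φ.totTn` is a cochain map of total complexes. [cite: Weibel1994, 1.2.6] -/
theorem totTn_totD (n : ℕ) (x : ↥(Tn R (X := X) n)) :
    φ.totTn (n + 1) (K.totD n x) = K'.totD n (φ.totTn n x) :=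
  Subtype.ext (φ.total_totalD x)

/-- **The map induced by a morphism of double complexes on the total cohomology.**
[cite: Weibel1994, 1.2.6] -/
def totCohMap (n : ℕ) : NatCochain.Cohomology K.totD n →ₗ[R] NatCochain.Cohomology K'.totD n :=
  NatCochain.Cohomology.map φ.totTn φ.totTn_totD n

/-- The transposed morphism `K.swap → K'.swap`. [folklore] -/
def swap : Hom K.swap K'.swap where
  f p q := φ.f q p
  f_d p q x := φ.f_δ q p x
  f_δ p q x := φ.f_d q p x

/-- Transposition intertwines `φ.totTn` and `φ.swap.totTn`. [folklore] -/
theorem swapTn_totTn (n : ℕ) (x : ↥(Tn R (X := X) n)) :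
    swapTn R n (φ.totTn n x) = φ.swap.totTn n (swapTn R n x) :=
  Subtype.ext (funext fun _ ↦ funext fun _ ↦ rfl)

/-- **The transposition isomorphisms `Hⁿ(Tot K) ≃ Hⁿ(Tot K.swap)` are natural.** [folklore] -/
theorem swapTotEquiv_totCohMap (n : ℕ) (c : NatCochain.Cohomology K.totD n) :
    K'.swapTotEquiv n (φ.totCohMap n c) = φ.swap.totCohMap n (K.swapTotEquiv n c) := by
  obtain ⟨z, rfl⟩ := NatCochain.Cohomology.mk_surjective K.totD n c
  simp only [swapTotEquiv, totCohMap, NatCochain.Cohomology.equivOfBijective_apply,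
    NatCochain.Cohomology.map_mk]
  congr 1

end Hom

/-! ### Morphisms of augmentations -/

namespace RowAugmentation

variable {K : ADoubleComplex R X} {K' : ADoubleComplex R X'}
  {A : ℕ → Type w₃} [∀ n, AddCommGroup (A n)] [∀ n, Module R (A n)]
  {A' : ℕ → Type w₄} [∀ n, AddCommGroup (A' n)] [∀ n, Module R (A' n)]

/-- A **morphism of row augmentations** over a morphism `φ : K → K'` of double complexes: a
cochain map `g : A → A'` with `ε' ∘ g = φ ∘ ε` (Bott–Tu (1982), §8: restriction of global forms and
of the Čech–de Rham double complex to a refinement commute). [cite: BottTu1982Forms, §8] -/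
structure Hom (E : K.RowAugmentation A) (E' : K'.RowAugmentation A') (φ : K.Hom K') where
  /-- the cochain map of the augmentation complexes -/
  g : ∀ n, A n →ₗ[R] A' n
  /-- `g` commutes with the differentials -/
  g_dA : ∀ n (a : A n), g (n + 1) (E.dA n a) = E'.dA n (g n a)
  /-- the augmentations intertwine `g` and `φ` -/
  ε_g : ∀ n (a : A n), E'.ε n (g n a) = φ.f 0 n (E.ε n a)

namespace Hom

variable {E : K.RowAugmentation A} {E' : K'.RowAugmentation A'} {φ : K.Hom K'} (ψ : Hom E E' φ)

/-- The map `Hⁿ(A) → Hⁿ(A')` induced by a morphism of augmentations. [folklore] -/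
def cohMap (n : ℕ) : NatCochain.Cohomology E.dA n →ₗ[R] NatCochain.Cohomology E'.dA n :=
  NatCochain.Cohomology.map ψ.g ψ.g_dA n

/-- `cohMap` on the class of a cocycle. [folklore] -/
theorem cohMap_mk (n : ℕ) (a : ↥(NatCochain.cocycles E.dA n)) :
    ψ.cohMap n (NatCochain.Cohomology.mk E.dA n a) =
      NatCochain.Cohomology.mk E'.dA n (NatCochain.Cohomology.mapCocycles ψ.g ψ.g_dA n a) :=
  rfl

/-- The augmentations into the total complexes intertwine `g` and `φ.totTn`. [folklore] -/
theorem totTn_εTot (n : ℕ) (a : A n) : φ.totTn n (E.εTot n a) = E'.εTot n (ψ.g n a) :=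
  Subtype.ext (by rw [Hom.coe_totTn, coe_εTot, coe_εTot, Hom.total_single, ψ.ε_g])

/-- **The augmentation square commutes on cohomology**: `totMap' ∘ Hⁿ(g) = Hⁿ(Tot φ) ∘ totMap`.
[cite: BottTu1982Forms, §8] -/
theorem totMap_cohMap (n : ℕ) (c : NatCochain.Cohomology E.dA n) :
    E'.totMap n (ψ.cohMap n c) = φ.totCohMap n (E.totMap n c) := by
  obtain ⟨a, rfl⟩ := NatCochain.Cohomology.mk_surjective E.dA n c
  rw [cohMap_mk, totMap_mk, totMap_mk, Hom.totCohMap, NatCochain.Cohomology.map_mk]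
  congr 1
  apply Subtype.ext
  rw [NatCochain.Cohomology.coe_mapCocycles, NatCochain.Cohomology.coe_mapCocycles,
    NatCochain.Cohomology.coe_mapCocycles, NatCochain.Cohomology.coe_mapCocycles]
  exact (ψ.totTn_εTot n a).symm

/-- With the augmentation isomorphisms of row-exact augmented complexes:
`totEquiv' (Hⁿ(g) c) = Hⁿ(Tot φ) (totEquiv c)`. [cite: Weibel1994, Lemma 2.7.3] -/
theorem totEquiv_cohMap (hK : K.RowExact) (hE : E.Exact) (hK' : K'.RowExact) (hE' : E'.Exact)
    (n : ℕ) (c : NatCochain.Cohomology E.dA n) :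
    E'.totEquiv hK' hE' n (ψ.cohMap n c) = φ.totCohMap n (E.totEquiv hK hE n c) :=
  ψ.totMap_cohMap n c

/-- The inverse form: `totEquiv'.symm (Hⁿ(Tot φ) x) = Hⁿ(g) (totEquiv.symm x)`.
[cite: Weibel1994, Lemma 2.7.3] -/
theorem totEquiv_symm_totCohMap (hK : K.RowExact) (hE : E.Exact) (hK' : K'.RowExact)
    (hE' : E'.Exact) (n : ℕ) (x : NatCochain.Cohomology K.totD n) :
    (E'.totEquiv hK' hE' n).symm (φ.totCohMap n x) = ψ.cohMap n ((E.totEquiv hK hE n).symm x) := by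
  apply (E'.totEquiv hK' hE' n).injective
  rw [LinearEquiv.apply_symm_apply, ψ.totEquiv_cohMap hK hE hK' hE', LinearEquiv.apply_symm_apply]

end Hom

end RowAugmentation

/-! ### Naturality of `rowColEquiv` -/

variable {K : ADoubleComplex R X} {K' : ADoubleComplex R X'}
  {A : ℕ → Type w₃} [∀ n, AddCommGroup (A n)] [∀ n, Module R (A n)]
  {A' : ℕ → Type w₄} [∀ n, AddCommGroup (A' n)] [∀ n, Module R (A' n)]
  {B : ℕ → Type w₅} [∀ n, AddCommGroup (B n)] [∀ n, Module R (B n)]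
  {B' : ℕ → Type w₆} [∀ n, AddCommGroup (B' n)] [∀ n, Module R (B' n)]

/-- **Naturality of the row/column comparison.** Let `φ : K → K'` be a morphism of anticommuting
double complexes, `ψ : (A, ε) → (A', ε')` a morphism of row augmentations over `φ` and
`χ : (B, η) → (B', η')` a morphism of column augmentations over `φ` (i.e. of row augmentations of
the swapped complexes over `φ.swap`). If all rows and columns are exact (augmentations included),
then `rowColEquiv' (Hⁿ(ψ) c) = Hⁿ(χ) (rowColEquiv c)` for every `c ∈ Hⁿ(A)`: the isomorphisms
`Hⁿ(A) ≃ Hⁿ(B)` of `DoubleComplexExactRows` are natural (Weibel (1994), Lemma 2.7.3 applied to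
both complexes; Bott–Tu (1982), §8, functoriality of the Čech–de Rham isomorphism under
refinement). [cite: Weibel1994, Lemma 2.7.3] -/
theorem rowColEquiv_natural (φ : K.Hom K') {E : K.RowAugmentation A} {E' : K'.RowAugmentation A'}
    (ψ : RowAugmentation.Hom E E' φ) {F : K.ColAugmentation B} {F' : K'.ColAugmentation B'}
    (χ : RowAugmentation.Hom F F' φ.swap)
    (hK : K.RowExact) (hE : E.Exact) (hKc : K.ColExact) (hF : F.Exact)
    (hK' : K'.RowExact) (hE' : E'.Exact) (hKc' : K'.ColExact) (hF' : F'.Exact)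
    (n : ℕ) (c : NatCochain.Cohomology E.dA n) :
    rowColEquiv E' F' hK' hE' hKc' hF' n (ψ.cohMap n c) =
      χ.cohMap n (rowColEquiv E F hK hE hKc hF n c) := by
  simp only [rowColEquiv, LinearEquiv.trans_apply]
  rw [ψ.totEquiv_cohMap hK hE hK' hE', φ.swapTotEquiv_totCohMap,
    χ.totEquiv_symm_totCohMap (K.rowExact_swap_iff.2 hKc) hF (K'.rowExact_swap_iff.2 hKc') hF']

/-- **Naturality when the row augmentation is fixed** (`A' = A`, `ψ = id`): the comparison
isomorphisms of the two complexes differ by `Hⁿ(χ)` — `rowColEquiv' c = Hⁿ(χ) (rowColEquiv c)`.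
This is the form used for two nested covers computing the cohomology of the same global complex
(Bott–Tu (1982), §8; Grauert–Remmert (1977), Kap. VI, introduction: the restriction
`Hq(𝔚, 𝒮) → Hq(𝔅, 𝒮)` is bijective, both being `Hq(X, 𝒮)`). [cite: Weibel1994, Lemma 2.7.3] -/
theorem rowColEquiv_natural_id (φ : K.Hom K') {E : K.RowAugmentation A} {E' : K'.RowAugmentation A}
    (ψ : RowAugmentation.Hom E E' φ) (hψ : ∀ n a, ψ.g n a = a) (hdA : ∀ n a, E.dA n a = E'.dA n a)
    {F : K.ColAugmentation B} {F' : K'.ColAugmentation B'} (χ : RowAugmentation.Hom F F' φ.swap)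
    (hK : K.RowExact) (hE : E.Exact) (hKc : K.ColExact) (hF : F.Exact)
    (hK' : K'.RowExact) (hE' : E'.Exact) (hKc' : K'.ColExact) (hF' : F'.Exact)
    (n : ℕ) (a : ↥(NatCochain.cocycles E.dA n)) :
    rowColEquiv E' F' hK' hE' hKc' hF' n
        (NatCochain.Cohomology.mk E'.dA n ⟨a, by
          rw [NatCochain.mem_cocycles_iff, ← hdA]; exact (NatCochain.mem_cocycles_iff E.dA).1 a.2⟩) =
      χ.cohMap n (rowColEquiv E F hK hE hKc hF n (NatCochain.Cohomology.mk E.dA n a)) := by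
  rw [← rowColEquiv_natural φ ψ χ hK hE hKc hF hK' hE' hKc' hF' n, ψ.cohMap_mk]
  congr 2
  exact Subtype.ext (hψ n a).symm

end ADoubleComplex

end Literature.Algebra.Homology
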